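import Literature.NumberTheory.Automorphic.Liu2021.AppendixC.RestOne
import Literature.AlgebraicGeometry.Motives.TateAbelianFiniteSteps
import Mathlib.Algebra.Colimit.Module
import Mathlib.RepresentationTheory.Basic
import Mathlib.FieldTheory.IsAlgClosed.AlgebraicClosure
import Mathlib.RingTheory.TensorProduct.Basic
import HarnessLib

/-!
# [Liu 2021, §4.3] the `ℓ`-adic cohomology of the Albanese tower `H¹_ét(A_∞ ⊗_{E,τ'} ℂ, ℚ_ℓ^{ac})` — REAL degree-one
# étale cohomology of the tree's Albanese varieties `A_K`, its Galois representation, the colimit over levels, and the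
# two POSITED data the printed text adds: the Hecke action of `𝔾(𝔸_F^∞)` and the Betti comparison along `ι_ℓ`

Topic `NumberTheory/Automorphic/Liu2021/AppendixC`; namespace `Literature.NumberTheory.Automorphic.Liu2021.AppendixC`,
dot-notation on the §4.2 datum `C : Sec42Data P5 isotropicAt` (`Glue.lean`).  Interface row VI-2′ («`H1TowerWithStructure`»,
ℓ-ADIC EDITION) of the cell `hodgecm-mathlib` (director GO 2026-08-28T00:59:49Z; carrier choice A-plan2 01:07:33Z); consumer =
the v2 split of `stub_mainGalois` of `Lines/a3-liu418.lean` (binder `hLiu418` = [Liu 2021, Thm 4.18]).  DEFINITIONS with bodies,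
bookkeeping theorems and TWO hypothesis structures; NO named fact (net Literature debt of this file: 0); nothing of [Liu2021] is
asserted.  HC_CM is proved only modulo the 7 printed citations until rung 0 closes; this file discharges none of them.

## The printed text (Y. Liu, *Fourier–Jacobi cycles and arithmetic relative trace formula*, Camb. J. Math. 9 (2021) =
## arXiv:2102.11518, author's TeX `FJcycle.tex` md5 6db49a74122d; shelf/Liu2021-Thm415-Thm418proof.md of the cell)

§4.3, l. 2152–2160 (print pp. 49–50), VERBATIM: «Now we study the `ℓ`-adic cohomology of `A_∞`. Take an embedding
`τ' : E → ℂ`, a rational prime `ℓ`, and an isomorphism `ι_ℓ : ℂ ≅ ℚ_ℓ^{ac}`. We have a canonical isomorphism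
`H¹_ét(A_K ⊗_{E,τ'} ℂ, ℚ_ℓ^{ac}) ≃ H¹_{B,τ'}(A_K, ℂ) ⊗_{ℂ,ι_ℓ} ℚ_ℓ^{ac}` by the comparison theorem. Put
`H¹_ét(A_∞ ⊗_{E,τ'} ℂ, ℚ_ℓ^{ac}) := colim_K H¹_ét(A_K ⊗_{E,τ'} ℂ, ℚ_ℓ^{ac})`, which is a
`ℚ_ℓ^{ac}[Gal(ℂ/τ'(E)) × 𝔾(𝔸_F^∞)]`-module.»  Here (§4.2, l. 2066–2074) `A_K := Alb_{X_K}`, «By functoriality, we obtain a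
projective system `{A_K}_K`», `A_∞ := lim_K A_K`, and «the Hecke correspondences provide a homomorphism
`𝔾(𝔸_F^∞) → Aut_E(A_∞)`».  Used in the proof of Thm 4.18 at l. 2254–2262 («By the comparison theorem, (4.2) induces the
following map … By Faltings' isogeny theorem [Fal83] …») and in the definition of `ρ_{τ',ι_ℓ}(μ,ε,χ)` (l. 2162–2174, Thm 4.15).

## What is REAL here and what is POSITED (read this; junk analysis)

* REAL (definitions over tree objects, no hypothesis).  The Albanese varieties are the tree's `C.A K : AbelianVariety E`
  (`Sec42Data.A`, an abelian variety over the CM field `E`, with transitions `C.Atr`, `C.albFunctor`).  For an abelian variety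
  `A` over a field `K` the tree has the Tate module `A.tateModule ℓ = lim A[ℓⁿ](K̄)` over `K̄ := AlgebraicClosure K`, the
  rational Tate module `V_ℓ A = A.rationalTateModule ℓ` with its Galois representation
  `A.rationalTateRep ℓ : Representation ℚ_[ℓ] Γ_K (V_ℓ A)`, `Γ_K := Field.absoluteGaloisGroup K` (`AVGaloisModule`), and the
  functoriality `AbelianVariety.rationalTateModuleMap ℓ f` with its `Γ_K`-equivariance (`TateAbelianFiniteSteps`).  We DEFINE
  `H¹_ét(A_K ⊗ Ē, ℚ_ℓ)` as the `ℚ_ℓ`-dual of `V_ℓ(A_K)` (`etaleH1`) — Milne, *Abelian varieties* (in Cornell–Silverman 1986),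
  Thm 15.1 (a): «`H¹(A_et, ℤ_l) ≅ Hom_{ℤ_l}(T_l A, ℤ_l)`» (held, lit1 LOCATORS-III §VI-2) — with the contragredient Galois
  representation (Mathlib `Representation.dual`), the transition maps as duals of `V_ℓ(Alb_{u^{K'}_K})`, and the colimit over
  the sufficiently small levels with the REVERSED inclusion order (`Module.DirectLimit`, exactly as `RestOne.ΩOf` does for
  `Hom_E(A_K, A_μ)_ℚ`; same index `RestOne.Idx C`), with the induced `Γ_E`-representation `towerRep` (`Module.DirectLimit.map`).
  Coefficients are extended to `ℚ_ℓ^{ac} := AlgebraicClosure ℚ_[ℓ]` by `TensorProduct` where the text wants `ℚ_ℓ^{ac}`.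
* GALOIS GROUP.  Print: `Gal(ℂ/τ'(E))` acting on `H¹_ét(A_K ⊗_{E,τ'} ℂ)` by transport of structure; here: `Γ_E = Gal(Ē/E)` acting on
  `H¹_ét(A_K ⊗_E Ē)`.  Restriction along any `E`-embedding `Ē ↪ ℂ` extending `τ'` maps `Aut(ℂ/τ'E)` ONTO `Gal(Ē/E)` and identifies
  the two modules; every character statement downstream (Thm 4.15) is insensitive to the choice (A-plan2 decision (2), 01:07:33Z).
  WEAKER-THAN-PRINT only in not carrying the transcendental part of `Aut(ℂ/τ'E)`, which acts through that quotient.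
* POSITED (hypothesis structures, instantiated by a consumer at its own datum — nothing asserted):
  (i) `EtaleHeckeDatum C ℓ`: the action of `𝔾(𝔸_F^∞) = C.G` on the tower («the Hecke correspondences provide a homomorphism
  `𝔾(𝔸_F^∞) → Aut_E(A_∞)`», l. 2074 — the tree's `Sec42Data` does NOT type the Hecke homomorphism on `A_∞`, see the module
  docstring of `Glue.lean`, «NOT TYPED»; it is a carrier there too: `Thm418Rest.rhoΩ`, `Prop413Data.rhoB`), commuting with `Γ_E`
  (the two actions commute because Hecke correspondences are defined over `E`), smooth, and with the level compatibility
  «`H¹(A_∞)^K = H¹(A_K)` for `K` sufficiently small» in the SHAPE of `Thm418Data.invariants` (`Thm418AsPrinted.lean`);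
  (ii) `BettiComparison`: for a consumer's Betti module `(H, rhoB)` = «`H¹_{B,τ'}(A_∞, ℂ)`, an admissible representation of
  `𝔾(𝔸_F^∞)`» (l. 2077–2081; the consumer's `Prop413Data.HB τ'`) and an isomorphism `ι : ℂ ≃+* ℚ_ℓ^{ac}`, the comparison
  isomorphism of l. 2154 in the colimit, as an `ι`-SEMILINEAR BIJECTION `H → ℚ_ℓ^{ac} ⊗_{ℚ_ℓ} H¹_ét(A_∞)` intertwining the two
  `G`-actions («`⊗_{ℂ,ι_ℓ} ℚ_ℓ^{ac}`» along an ISOMORPHISM `ι_ℓ` is restriction of scalars, so a semilinear bijection is exactly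
  an isomorphism `H ⊗_{ℂ,ι_ℓ} ℚ_ℓ^{ac} ≅ ℚ_ℓ^{ac} ⊗ H¹_ét`).  The genuinely absent comparison leg «`T_ℓ(A) ≃ T_ℓ(A ⊗_{E,τ'} ℂ)`
  equivariantly» (to be composed with the tree's PROVED `HodgeTheory.tateModuleComparison`, `hOneToTateModule` at `ℂ` and Lemma
  2.4 (1) `albanese_bettiOne_pullback_bijective`) is a separate row (VI-2″), not a field here.
* Existence of `ι_ℓ` (non-vacuity of the parameter): `ℂ` and `AlgebraicClosure ℚ_[ℓ]` are algebraically closed of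
  characteristic `0` and cardinality `𝔠`, so `Nonempty (ℂ ≃+* AlgebraicClosure ℚ_[ℓ])` by Mathlib's
  `IsAlgClosed.ringEquiv_of_equiv_of_charZero` — not needed and not proved here.
* Smells checked: no `sorry`; no instance declared (carriers are `abbrev`s so Mathlib's instances apply); `DecidableEq` on the
  index through `open scoped Classical` as in `RestOne`; the empty index (no small level) cannot occur (`K₀` itself is a level);
  `Module.DirectLimit` needs no directedness for the constructions used (`of`, `of_f`, `map`, `hom_ext`).

## Contents
* `Sec42Data.etaleH1 C ℓ K`, `Sec42Data.etaleH1Rep C ℓ K` (+ `etaleH1Rep_apply`);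
* `Sec42Data.etSysObj`, `Sec42Data.etSys` (+ `etSys_apply`, `etaleH1Rep_comp_etSys`), `Sec42Data.etaleH1Tower C ℓ`,
  `Sec42Data.toTower C ℓ K` (+ `toTower_pull`), `Sec42Data.towerRep C ℓ` (+ `towerRep_of`, `towerRep_toTower`);
* `Sec42Data.EtaleHeckeDatum C ℓ`, `Sec42Data.EtaleHeckeDatum.invariants` (+ `mem_invariants_iff`),
  `Sec42Data.BettiComparison C ℓ X H rhoB ι`.

## References
* [Liu2021] §4.2 l. 2066–2081, §4.3 l. 2152–2174, Thm 4.15 l. 2177–2182, Thm 4.18 proof l. 2247–2268.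
* [Milne1986AbelianVarieties] J. S. Milne, *Abelian varieties*, in Cornell–Silverman, *Arithmetic Geometry* (1986), Thm 15.1.
* [SerreTate1968] §1 (the `ℓ`-adic representation on `V_ℓ`); [Faltings1983Endlichkeit] (consumed downstream, not here).
-/

noncomputable section

open CategoryTheory NumberField
open scoped TensorProduct

namespace Literature.NumberTheory.Automorphic.Liu2021.AppendixC

open Literature.AlgebraicGeometry.Motives (AbelianVariety)
open Literature.AlgebraicGeometry.Motives.AbelianVariety (rationalTateModuleMap rationalTateModuleMap_id
  rationalTateModuleMap_comp rationalTateRep_rationalTateModuleMap)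

variable {F E : Type} [Field F] [NumberField F] [IsTotallyReal F] [Field E] [NumberField E] [Algebra F E]
  [IsTotallyComplex E] [Algebra.IsQuadraticExtension F E]
variable {P5 : PropC5Data F E} {isotropicAt : ℕ → Prop}

namespace Sec42Data

variable (C : Sec42Data P5 isotropicAt) (ℓ : ℕ) [Fact ℓ.Prime]

open scoped Classical

/-! ## 1. `H¹_ét(A_K ⊗_E Ē, ℚ_ℓ)` of one level, with its Galois representation -/

/-- **`H¹_ét(A_K ⊗_E Ē, ℚ_ℓ) := Hom_{ℚ_ℓ}(V_ℓ(A_K), ℚ_ℓ)`**, the `ℚ_ℓ`-dual of the rational Tate module of the Albanese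
`A_K = Alb_{X_K}` (an abelian variety over `E`; the tree's `Sec42Data.A`).  Milne, *Abelian varieties*, Thm 15.1 (a):
«`H¹(A_et, ℤ_l) ≅ Hom_{ℤ_l}(T_l A, ℤ_l)`», tensored with `ℚ_ℓ`; the `ℚ_ℓ`-form of [Liu2021] §4.3 l. 2152–2158 before `⊗ ℚ_ℓ^{ac}`.
[cite: Milne1986AbelianVarieties, Thm 15.1 (a)] [cite: Liu2021, §4.3 (FJcycle.tex l. 2152–2158)] -/
abbrev etaleH1 (K : C5.SmallLevel C.S.K₀) : Type :=
  Module.Dual ℚ_[ℓ] ((C.A K).rationalTateModule ℓ)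

/-- The Galois representation of `Γ_E = Gal(Ē/E)` on `H¹_ét(A_K ⊗_E Ē, ℚ_ℓ)`: the CONTRAGREDIENT of the tree's
`(C.A K).rationalTateRep ℓ` on `V_ℓ(A_K)` (Mathlib `Representation.dual`: `σ ↦ ᵗρ(σ⁻¹)`).  Print: «a
`ℚ_ℓ^{ac}[Gal(ℂ/τ'(E)) × 𝔾(𝔸_F^∞)]`-module» (l. 2160) — the Galois factor, over `ℚ_ℓ`, at one level, read on `Gal(Ē/E)`
(module docstring, GALOIS GROUP). [cite: Liu2021, §4.3 (FJcycle.tex l. 2160)] [cite: SerreTate1968, §1] -/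
abbrev etaleH1Rep (K : C5.SmallLevel C.S.K₀) :
    Representation ℚ_[ℓ] (Field.absoluteGaloisGroup E) (C.etaleH1 ℓ K) :=
  ((C.A K).rationalTateRep ℓ).dual

/-- Unfolding: `σ` acts on a linear form `φ` on `V_ℓ(A_K)` by `φ ↦ φ ∘ ρ(σ⁻¹)`. [cite: Liu2021, §4.3 (FJcycle.tex l. 2160)] -/
theorem etaleH1Rep_apply (K : C5.SmallLevel C.S.K₀) (σ : Field.absoluteGaloisGroup E) (φ : C.etaleH1 ℓ K)
    (v : (C.A K).rationalTateModule ℓ) :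
    C.etaleH1Rep ℓ K σ φ v = φ ((C.A K).rationalTateRep ℓ σ⁻¹ v) := by
  simp [Representation.dual_apply, Module.Dual.transpose_apply]

/-! ## 2. The direct system over the sufficiently small levels and its colimit `H¹_ét(A_∞)` -/

/-- The objects `K ↦ H¹_ét(A_K ⊗_E Ē, ℚ_ℓ)` of the DIRECT system, on the reversed level index `RestOne.Idx C = (C5.SmallLevel K₀)ᵒᵈ`
(`A_∞ = lim_K A_K`, so `H¹(A_∞) = colim_K H¹(A_K)`, l. 2158). [cite: Liu2021, §4.3 (FJcycle.tex l. 2158)] -/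
abbrev etSysObj (i : RestOne.Idx C) : Type :=
  C.etaleH1 ℓ (OrderDual.ofDual i)

/-- The transition maps of the direct system: for `K' ⊆ K` the pull-back `H¹_ét(A_K) → H¹_ét(A_{K'})`, i.e. the DUAL of
`V_ℓ(Alb_{u^{K'}_K}) : V_ℓ(A_{K'}) → V_ℓ(A_K)` (`Sec42Data.Atr`, «By functoriality, we obtain a projective system `{A_K}_K`»,
l. 2070). [cite: Liu2021, §4.2 (FJcycle.tex l. 2066–2072) and §4.3 (l. 2158)] -/
def etSys (i j : RestOne.Idx C) (h : i ≤ j) : C.etSysObj ℓ i →ₗ[ℚ_[ℓ]] C.etSysObj ℓ j :=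
  (rationalTateModuleMap ℓ
    (C.Atr (homOfLE (show OrderDual.ofDual j ≤ OrderDual.ofDual i from h)))).dualMap

/-- Unfolding of a transition map: `(etSys φ) v = φ (V_ℓ(Alb_u) v)`. [cite: Liu2021, §4.3 (FJcycle.tex l. 2158)] -/
theorem etSys_apply (i j : RestOne.Idx C) (h : i ≤ j) (φ : C.etSysObj ℓ i)
    (v : (C.A (OrderDual.ofDual j)).rationalTateModule ℓ) :
    C.etSys ℓ i j h φ v =
      φ (rationalTateModuleMap ℓ (C.Atr (homOfLE (show OrderDual.ofDual j ≤ OrderDual.ofDual i from h))) v) :=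
  rfl

/-- The transition maps are `Γ_E`-equivariant (they come from homomorphisms of abelian varieties over `E`; the tree's
`rationalTateRep_rationalTateModuleMap`, dualised). [cite: Liu2021, §4.3 (FJcycle.tex l. 2158–2160)] -/
theorem etaleH1Rep_comp_etSys (σ : Field.absoluteGaloisGroup E) (i j : RestOne.Idx C) (h : i ≤ j) :
    (C.etaleH1Rep ℓ (OrderDual.ofDual j) σ) ∘ₗ C.etSys ℓ i j h =
      C.etSys ℓ i j h ∘ₗ (C.etaleH1Rep ℓ (OrderDual.ofDual i) σ) := by
  apply LinearMap.ext
  intro φ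
  apply LinearMap.ext
  intro v
  simp only [LinearMap.coe_comp, Function.comp_apply, etSys_apply, Representation.dual_apply,
    Module.Dual.transpose_apply, LinearMap.coe_comp, Function.comp_apply]
  rw [rationalTateRep_rationalTateModuleMap]

/-- **`H¹_ét(A_∞ ⊗_E Ē, ℚ_ℓ) := colim_K H¹_ét(A_K ⊗_E Ē, ℚ_ℓ)`** over the sufficiently small levels `K ⊆ K₀` (l. 2158, over
`ℚ_ℓ`; the text's `ℚ_ℓ^{ac}`-module is `ℚ_ℓ^{ac} ⊗_{ℚ_ℓ}` this, §3). [cite: Liu2021, §4.3 (FJcycle.tex l. 2158)] -/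
abbrev etaleH1Tower : Type :=
  Module.DirectLimit (C.etSysObj ℓ) (C.etSys ℓ)

/-- The canonical map `H¹_ét(A_K) → H¹_ét(A_∞)` into the colimit (`Module.DirectLimit.of`).
[cite: Liu2021, §4.3 (FJcycle.tex l. 2158)] -/
def toTower (K : C5.SmallLevel C.S.K₀) : C.etaleH1 ℓ K →ₗ[ℚ_[ℓ]] C.etaleH1Tower ℓ :=
  Module.DirectLimit.of ℚ_[ℓ] (RestOne.Idx C) (C.etSysObj ℓ) (C.etSys ℓ) (OrderDual.toDual K)

/-- Compatibility of the canonical maps with pull-back along `Alb_{u^{K'}_K}` for `K' ⊆ K` (`Module.DirectLimit.of_f`), the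
shape of `RestOne.resOf_pull`. [cite: Liu2021, §4.3 (FJcycle.tex l. 2158)] -/
theorem toTower_pull {K K' : C5.SmallLevel C.S.K₀} (f : K' ⟶ K) (φ : C.etaleH1 ℓ K) :
    C.toTower ℓ K' ((rationalTateModuleMap ℓ (C.Atr f)).dualMap φ) = C.toTower ℓ K φ := by
  have hle : K' ≤ K := leOfHom f
  have hf : f = homOfLE hle := Subsingleton.elim _ _
  have key := @Module.DirectLimit.of_f ℚ_[ℓ] _ (RestOne.Idx C) _ (C.etSysObj ℓ) _ _ (C.etSys ℓ) _
    (OrderDual.toDual K) (OrderDual.toDual K') hle φ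
  have hsys : C.etSys ℓ (OrderDual.toDual K) (OrderDual.toDual K') hle φ =
      (rationalTateModuleMap ℓ (C.Atr f)).dualMap φ := by
    rw [hf]; rfl
  rw [hsys] at key
  exact key

/-- **The Galois representation of `Γ_E` on `H¹_ét(A_∞ ⊗_E Ē, ℚ_ℓ)`**, induced on the colimit by the level-wise contragredient
representations (`Module.DirectLimit.map` of the compatible family `etaleH1Rep_comp_etSys`): the Galois factor of «a
`ℚ_ℓ^{ac}[Gal(ℂ/τ'(E)) × 𝔾(𝔸_F^∞)]`-module» (l. 2160), over `ℚ_ℓ`, read on `Gal(Ē/E)`.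
[cite: Liu2021, §4.3 (FJcycle.tex l. 2160)] -/
def towerRep : Representation ℚ_[ℓ] (Field.absoluteGaloisGroup E) (C.etaleH1Tower ℓ) where
  toFun σ := Module.DirectLimit.map (fun i => C.etaleH1Rep ℓ (OrderDual.ofDual i) σ)
    (fun i j h => C.etaleH1Rep_comp_etSys ℓ σ i j h)
  map_one' := by
    refine Module.DirectLimit.hom_ext (fun i => ?_)
    apply LinearMap.ext
    intro x
    simp only [LinearMap.coe_comp, Function.comp_apply, Module.DirectLimit.map_apply_of, map_one,
      Module.End.one_apply]
  map_mul' σ τ := by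
    refine Module.DirectLimit.hom_ext (fun i => ?_)
    apply LinearMap.ext
    intro x
    simp only [LinearMap.coe_comp, Function.comp_apply, Module.DirectLimit.map_apply_of, map_mul,
      Module.End.mul_apply]

/-- Naturality of the canonical maps for the Galois action, on the reversed index: `σ · [φ]_i = [σ · φ]_i`
(`Module.DirectLimit.map_apply_of`). [cite: Liu2021, §4.3 (FJcycle.tex l. 2158–2160)] -/
theorem towerRep_of (i : RestOne.Idx C) (σ : Field.absoluteGaloisGroup E) (φ : C.etSysObj ℓ i) :
    C.towerRep ℓ σ (Module.DirectLimit.of ℚ_[ℓ] (RestOne.Idx C) (C.etSysObj ℓ) (C.etSys ℓ) i φ) =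
      Module.DirectLimit.of ℚ_[ℓ] (RestOne.Idx C) (C.etSysObj ℓ) (C.etSys ℓ) i
        (C.etaleH1Rep ℓ (OrderDual.ofDual i) σ φ) := by
  simp only [towerRep, MonoidHom.coe_mk, OneHom.coe_mk]
  exact Module.DirectLimit.map_apply_of _ _ φ

/-- Naturality of the canonical maps for the Galois action: `σ · (toTower K φ) = toTower K (σ · φ)`.
[cite: Liu2021, §4.3 (FJcycle.tex l. 2158–2160)] -/
theorem towerRep_toTower (K : C5.SmallLevel C.S.K₀) (σ : Field.absoluteGaloisGroup E) (φ : C.etaleH1 ℓ K) :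
    C.towerRep ℓ σ (C.toTower ℓ K φ) = C.toTower ℓ K (C.etaleH1Rep ℓ K σ φ) :=
  C.towerRep_of ℓ (OrderDual.toDual K) σ φ

/-! ## 3. The POSITED Hecke action and the POSITED Betti comparison (hypothesis structures; nothing asserted) -/

/-- **The Hecke action on `H¹_ét(A_∞ ⊗_E Ē, ℚ_ℓ)`** — POSITED.  «The Hecke correspondences provide a homomorphism
`𝔾(𝔸_F^∞) → Aut_E(A_∞)`» (§4.2, l. 2074) makes `H¹_ét(A_∞ ⊗_{E,τ'} ℂ, ℚ_ℓ^{ac})` «a `ℚ_ℓ^{ac}[Gal(ℂ/τ'(E)) × 𝔾(𝔸_F^∞)]`-module»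
(§4.3, l. 2160); `H¹_{B,τ'}(A_∞, ℂ) = colim_K H¹_{B,τ'}(A_K, ℂ)` «is an admissible representation of `𝔾(𝔸_F^∞)`» (l. 2077–2081).
The tree's §4.2 datum `Sec42Data` does not type the Hecke homomorphism on `A_∞` (module docstring of `Glue.lean`), so the
action is a FIELD here, as `Thm418Rest.rhoΩ` / `Prop413Data.rhoB` are; its printed attributes are the `Prop` fields:
`comm` — it commutes with `Γ_E` (a `Gal × 𝔾`-module); `smooth` — every class is fixed by some sufficiently small level;
`levelCompat` — «`H¹(A_∞)^K = H¹(A_K)`» for `K` sufficiently small, in the SHAPE of `Thm418Data.invariants` / Thm 4.18 (1)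
(injective with image the `K`-invariants, below one threshold `K₁`).  A consumer instantiates this structure at ITS OWN tower;
`∀ C, Nonempty (EtaleHeckeDatum C ℓ)` is not claimed. [cite: Liu2021, §4.2 (FJcycle.tex l. 2074, 2077–2081) and §4.3 (l. 2160)] -/
structure EtaleHeckeDatum : Type where
  /-- ⟨CARRIER⟩ the action of `g ∈ 𝔾(𝔸_F^∞) = C.G` on `H¹_ét(A_∞ ⊗_E Ē, ℚ_ℓ)` through the Hecke correspondences (l. 2074, 2160). -/
  rhoEt : Representation ℚ_[ℓ] C.G (C.etaleH1Tower ℓ)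
  /-- «`ℚ_ℓ^{ac}[Gal(ℂ/τ'(E)) × 𝔾(𝔸_F^∞)]`-module» (l. 2160): the Hecke action commutes with the Galois action. -/
  comm : ∀ (g : C.G) (σ : Field.absoluteGaloisGroup E) (x : C.etaleH1Tower ℓ),
    rhoEt g (C.towerRep ℓ σ x) = C.towerRep ℓ σ (rhoEt g x)
  /-- «admissible representation» (l. 2081), smoothness half: every class is fixed by some sufficiently small level `K ⊆ K₀`. -/
  smooth : ∀ x : C.etaleH1Tower ℓ, ∃ K : C5.SmallLevel C.S.K₀, ∀ k ∈ K.1.1, rhoEt k x = x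
  /-- Level compatibility (the étale form of Thm 4.18 (1)'s «`Ω(μ)^K`» bookkeeping / Lemma 2.4 (1) with the Galois covers
  `X_{K'} → X_K`): below some threshold `K₁`, `H¹_ét(A_K) → H¹_ét(A_∞)` is injective with image the `K`-invariants. -/
  levelCompat : ∃ K₁ : C5.SmallLevel C.S.K₀, ∀ K : C5.SmallLevel C.S.K₀, K.1 ≤ K₁.1 →
    Function.Injective (C.toTower ℓ K) ∧ Set.range (C.toTower ℓ K) = {x | ∀ k ∈ K.1.1, rhoEt k x = x}

namespace EtaleHeckeDatum

variable {C ℓ}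

/-- The `K`-invariants `H¹_ét(A_∞)^K` of a subgroup `K ≤ 𝔾(𝔸_F^∞)` for the Hecke action, as a set — the shape of
`Thm418Data.invariants`. [cite: Liu2021, Thm 4.18 (1) (FJcycle.tex l. 2239) and §4.3 (l. 2160)] -/
def invariants (X : C.EtaleHeckeDatum ℓ) (K : Subgroup C.G) : Set (C.etaleH1Tower ℓ) :=
  {x | ∀ k ∈ K, X.rhoEt k x = x}

/-- Unfolding of `H¹_ét(A_∞)^K`. [cite: Liu2021, Thm 4.18 (1) (FJcycle.tex l. 2239)] -/
theorem mem_invariants_iff (X : C.EtaleHeckeDatum ℓ) (K : Subgroup C.G) (x : C.etaleH1Tower ℓ) :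
    x ∈ X.invariants K ↔ ∀ k ∈ K, X.rhoEt k x = x :=
  Iff.rfl

/-- The Galois action preserves the `K`-invariants (from `comm`). [cite: Liu2021, §4.3 (FJcycle.tex l. 2160)] -/
theorem towerRep_mem_invariants (X : C.EtaleHeckeDatum ℓ) (K : Subgroup C.G) (σ : Field.absoluteGaloisGroup E)
    {x : C.etaleH1Tower ℓ} (hx : x ∈ X.invariants K) : C.towerRep ℓ σ x ∈ X.invariants K := by
  intro k hk
  rw [X.comm k σ x, hx k hk]

/-- Below the threshold of `levelCompat`, the range of `H¹_ét(A_K) → H¹_ét(A_∞)` is `H¹_ét(A_∞)^K` (restated with `invariants`).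
[cite: Liu2021, Thm 4.18 (1) (FJcycle.tex l. 2239) and §4.3 (l. 2158)] -/
theorem exists_range_toTower_eq_invariants (X : C.EtaleHeckeDatum ℓ) :
    ∃ K₁ : C5.SmallLevel C.S.K₀, ∀ K : C5.SmallLevel C.S.K₀, K.1 ≤ K₁.1 →
      Function.Injective (C.toTower ℓ K) ∧ Set.range (C.toTower ℓ K) = X.invariants K.1.1 :=
  X.levelCompat

end EtaleHeckeDatum

/-- **The Betti–étale comparison in the colimit, along `ι_ℓ`** — POSITED.  «We have a canonical isomorphism
`H¹_ét(A_K ⊗_{E,τ'} ℂ, ℚ_ℓ^{ac}) ≃ H¹_{B,τ'}(A_K, ℂ) ⊗_{ℂ,ι_ℓ} ℚ_ℓ^{ac}` by the comparison theorem» (§4.3, l. 2154–2156), passed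
to `colim_K` and read against a consumer's Betti module `(H, rhoB)` («`H¹_{B,τ'}(A_∞, ℂ) := colim_K H¹_{B,τ'}(A_K, ℂ)`, an
admissible representation of `𝔾(𝔸_F^∞)`», l. 2079–2081 — the consumer's `Prop413Data.HB τ'` / `rhoB τ'`) and an isomorphism
`ι : ℂ ≃+* ℚ_ℓ^{ac} = AlgebraicClosure ℚ_[ℓ]` («an isomorphism `ι_ℓ : ℂ ≅ ℚ_ℓ^{ac}`», l. 2152).  Since `ι` is an ISOMORPHISM,
`H ⊗_{ℂ,ι} ℚ_ℓ^{ac}` is `H` with `ℚ_ℓ^{ac}` acting through `ι⁻¹`, so the printed isomorphism is typed as an `ι`-SEMILINEAR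
BIJECTION `cmp : H → ℚ_ℓ^{ac} ⊗_{ℚ_ℓ} H¹_ét(A_∞ ⊗_E Ē, ℚ_ℓ)` intertwining `rhoB` with the Hecke action `X.rhoEt` (the comparison
is functorial, hence compatible with the Hecke correspondences — used at l. 2254–2257 «(4.2) induces the following map»).
A consumer instantiates it at ITS OWN `(H, rhoB, ι)`; nothing is claimed for all data.  (This is the row VI-2′ hypothesis
field (h4); the absent leg «`T_ℓ(A) ≃ T_ℓ(A ⊗_{E,τ'} ℂ)` equivariantly», to be composed with the tree's
`HodgeTheory.tateModuleComparison` / `hOneToTateModule` at `ℂ` and Lemma 2.4 (1), is row VI-2″, not here.)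
[cite: Liu2021, §4.3 (FJcycle.tex l. 2152–2160) and Thm 4.18 proof (l. 2254–2257)] -/
structure BettiComparison (X : C.EtaleHeckeDatum ℓ) (H : Type) [AddCommGroup H] [Module ℂ H]
    (rhoB : Representation ℂ C.G H) (ι : ℂ ≃+* AlgebraicClosure ℚ_[ℓ]) : Type where
  /-- ⟨CARRIER⟩ the comparison isomorphism `H¹_{B,τ'}(A_∞, ℂ) ⊗_{ℂ,ι_ℓ} ℚ_ℓ^{ac} ≃ H¹_ét(A_∞ ⊗_{E,τ'} ℂ, ℚ_ℓ^{ac})` (l. 2154,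
  in the colimit), as an `ι`-semilinear map into `ℚ_ℓ^{ac} ⊗_{ℚ_ℓ} H¹_ét(A_∞ ⊗_E Ē, ℚ_ℓ)`. -/
  cmp : H →ₛₗ[(ι : ℂ →+* AlgebraicClosure ℚ_[ℓ])] AlgebraicClosure ℚ_[ℓ] ⊗[ℚ_[ℓ]] C.etaleH1Tower ℓ
  /-- «isomorphism» (l. 2154): the semilinear comparison map is a bijection. -/
  bijective : Function.Bijective cmp
  /-- The comparison intertwines the Hecke actions on the two sides (functoriality of the comparison theorem; l. 2160, 2254). -/
  comm : ∀ (g : C.G) (h : H), cmp (rhoB g h) = (X.rhoEt g).baseChange (AlgebraicClosure ℚ_[ℓ]) (cmp h)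

namespace BettiComparison

variable {C ℓ} {X : C.EtaleHeckeDatum ℓ} {H : Type} [AddCommGroup H] [Module ℂ H] {rhoB : Representation ℂ C.G H}
  {ι : ℂ ≃+* AlgebraicClosure ℚ_[ℓ]}

/-- The comparison map is injective (half of `bijective`). [cite: Liu2021, §4.3 (FJcycle.tex l. 2154)] -/
theorem injective (B : C.BettiComparison ℓ X H rhoB ι) : Function.Injective B.cmp :=
  B.bijective.1

/-- The comparison map is surjective (half of `bijective`). [cite: Liu2021, §4.3 (FJcycle.tex l. 2154)] -/
theorem surjective (B : C.BettiComparison ℓ X H rhoB ι) : Function.Surjective B.cmp :=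
  B.bijective.2

/-- The comparison carries `H^K` (Betti `K`-invariants) into `H¹_ét(A_∞)^K` (from `comm`).
[cite: Liu2021, §4.3 (FJcycle.tex l. 2154–2160)] -/
theorem cmp_mem_of_forall_eq (B : C.BettiComparison ℓ X H rhoB ι) (K : Subgroup C.G) {h : H}
    (hh : ∀ k ∈ K, rhoB k h = h) :
    ∀ k ∈ K, (X.rhoEt k).baseChange (AlgebraicClosure ℚ_[ℓ]) (B.cmp h) = B.cmp h := by
  intro k hk
  rw [← B.comm k h, hh k hk]

end BettiComparison

end Sec42Data

end Literature.NumberTheory.Automorphic.Liu2021.AppendixC
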